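import Summits.CriticalPhenomena.PercolationContinuityZ3.Theorems.PercNearOneGluingNoHeavyLowerTailThreePartitionCubeCover
import Summits.CriticalPhenomena.PercolationContinuityZ3.Theorems.PercNearOneGluingNoHeavyLowerTailThreePartitionCubeBatch
import Summits.CriticalPhenomena.PercolationContinuityZ3.Theorems.PercNearOneGluingNoHeavyLowerTailThreePartitionCubeRepr
import Summits.CriticalPhenomena.PercolationContinuityZ3.Theorems.PercNearOneGluingNoHeavyLowerTailThreePartitionCubeFilters
import Summits.CriticalPhenomena.PercolationContinuityZ3.Theorems.PercNearOneGluingNoHeavyLowerTailThreePartitionCubeSymB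

/-!
# Twisted three-partition positivity (★★) = (M⁺-3) on SIX letters: soundness of the checker, XIII — **chunk ⇒ relative dual cone, and the symmetry
# normalisation: every conditioned pair has a coordinate permutation whose image is a tested node**

Support file (cell `prim-sahi`, seat `prim-sahi-typer` gen 34/35; `--supports stmt-CriticalPhenomena-4575`).  Pure; no `sorry`, standard axioms.
* `codeRel_of_good` — a GOOD triple (file VII: it sat in a lane of a valid batch that passed `packedTest`) satisfies `CodeRel m (prof m U V t) D`
  at every twist `t` (`packedTest_sound`, file IV; `2^m ≤ 64`);
* **`inDualRel_of_good`** — `Good m (encA m ↑A) (encA m ↑B) D` (the conclusion of the checker, file VII) with `D ⊇ ↓Free` (as bits) puts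
  `y ↦ N_τ(A,B,{y})` in `PairSat.InDualRel _ N` for EVERY twist `τ` (given the numeric identity `hpow` of `profileArr_encA`): the up-set `U`
  of the relative dual cone is read as the code set `U.image encS` (`CodeUp`), which contains the complement of `D`;
* **`inDualRel_of_chunkCheck`** — if a chunk containing the node of a conditioned pair passes and the node's keys are sorted with the tie
  rule, the profile is in the relative dual cone for every twist (`2^m ≤ 64`, `hpow`, `ChainIdOK m`; files VII–IX, XII); `inDualRel_of_root`
  — the empty node;
* `image_encS_mapIso` — the code set of the permuted family is the `cperm`-image of the code set;
* `statTri_lt_C40` — for `m ≤ 6` the second-order part of a key is `< 2^40`;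
* **`inDualRel_of_chunks`** — for `2^m ≤ 64`, `m ≤ 6`, the numeric identity `hpow`, `ChainIdOK m`, a passing ROOT chunk and, for every first
  code `x < 2^m`, a selecting chunk family passing at every residue: EVERY conditioned pair `(A, B)` has its profile `y ↦ N_τ(A,B,{y})` in the
  relative dual cone w.r.t. `coGen A ∪ coGen B`, for every twist `τ`.  Proof: sort the coordinates by `(K_i, t_i)` (`exists_perm_monotone`),
  transport the pair (`pairCond_mapIso`), colour the least code first (swap by `PairCond.symm` / `threePartNT_swap12` if needed), read the keys
  through the statistics (files X–XI) to get `keySorted`/`tieOk`, apply `inDualRel_of_chunkCheck`, and come back with `inDualRel_profile_of_perm`.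
* **`threePartNT_nonneg_of_chunks`** — hence `N_τ(𝒰,𝒱,𝒲) ≥ 0` for all up-sets (`threePartNT_nonneg_of_pairCondRel`). [this work]
-/

namespace Summit.CriticalPhenomena.PercolationContinuityZ3.Theorems.ThreePartition.Cube

open Finset SahiGridPattern.Pair43 SahiC3Cube
open scoped Classical symmDiff

variable {m : ℕ}

/-! ### A good triple puts the profile in the relative dual cone -/

/-- **A good triple satisfies the code-level relative dual-cone statement at every twist** (`packedTest_sound`). [this work] -/
theorem codeRel_of_good (hm : 2 ^ m ≤ 64) {U V D : ℕ} (h : Good m U V D) (t : ℕ) (ht : t < 2 ^ m) : CodeRel m (prof m U V t) D := by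
  obtain ⟨b, ⟨fU, fV, fD, hpu, hpv, hpd, hf⟩, htest, i, hi, hU, hV, hD⟩ := h
  have h1 : ∀ i < b.n, fU i < 2 ^ 64 := fun i hi => (hf i hi).1
  have h2 : ∀ i < b.n, fV i < 2 ^ 64 := fun i hi => (hf i hi).2.1
  have h3 : ∀ i < b.n, fD i < 2 ^ 64 := fun i hi => (hf i hi).2.2
  rw [hpu, laneOf_ofLanes (fun i hi => (h1 i hi).trans_le pow64_le_LW) hi] at hU
  rw [hpv, laneOf_ofLanes (fun i hi => (h2 i hi).trans_le pow64_le_LW) hi] at hV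
  rw [hpd, laneOf_ofLanes (fun i hi => (h3 i hi).trans_le pow64_le_LW) hi] at hD
  subst hU; subst hV; subst hD
  exact packedTest_sound hm hpu hpv hpd h1 h2 h3 htest t ht i hi

/-- **GOOD ⇒ RELATIVE DUAL CONE.**  If the triple `(encA A, encA B, D)` is good and every code below a free point w.r.t. `N` is in `D`, then
for every twist `τ` the profile `y ↦ N_τ(A,B,{y})` lies in the relative dual cone w.r.t. `N` (granted `2^m ≤ 64` and the numeric identity
`hpow` of `profileArr_encA`). [this work] -/
theorem inDualRel_of_good (hm : 2 ^ m ≤ 64)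
    (hpow : ∀ r < 2 ^ m, 2 <<< pc m r = 2 * ((List.range (2 ^ m)).filter fun s => sub s r).length)
    {A B N : Finset (Set (Fin m))} {D : ℕ} (hD : ∀ y < 2 ^ m, ∀ q, PairSat.Free N q → pt m y ⊆ q → D.testBit y = true)
    (hgood : Good m (encA m ↑A) (encA m ↑B) D) (τ : Set (Fin m)) :
    PairSat.InDualRel (fun y : Set (Fin m) => threePartNT τ (↑A : Set (Set (Fin m))) ↑B {y}) N := by
  intro U hU hfree
  -- the code set of `U` is `U.image encS`
  have hinj : ∀ a ∈ U, ∀ b ∈ U, encS a = encS b → a = b := fun a _ b _ h => by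
    have h' := congrArg (pt m) h
    rwa [pt_encS, pt_encS] at h'
  have hmemC : ∀ y, y ∈ U.image encS ↔ y < 2 ^ m ∧ pt m y ∈ U := fun y => by
    rw [mem_image]
    constructor
    · rintro ⟨u, hu, rfl⟩; exact ⟨encS_lt u, by rw [pt_encS]; exact hu⟩
    · rintro ⟨hy, hu⟩; exact ⟨pt m y, hu, encS_pt hy⟩
  have hup : CodeUp m (U.image encS) := by
    refine ⟨fun y hy => mem_range.2 ((hmemC y).1 hy).1, fun y hy w hw hsub => ?_⟩
    obtain ⟨hylt, hyU⟩ := (hmemC y).1 hy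
    rw [sub_eq_true_iff _ hylt] at hsub
    exact (hmemC w).2 ⟨hw, hU hsub hyU⟩
  have hcov : ∀ y < 2 ^ m, D.testBit y = false → y ∈ U.image encS := by
    intro y hy hDy
    by_contra hyC
    have hyU : pt m y ∉ U := fun h => hyC ((hmemC y).2 ⟨hy, h⟩)
    obtain ⟨a, ha, hya⟩ := PairSat.exists_coGen_ge_of_not_mem hyU
    have h' := hD y hy a (hfree a ha) hya
    rw [hDy] at h'
    exact Bool.false_ne_true h'
  have h0 : 0 ≤ ∑ y ∈ U.image encS, prof m (encA m ↑A) (encA m ↑B) (encS τ) y :=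
    codeRel_of_good hm hgood (encS τ) (encS_lt τ) _ hup hcov
  rw [sum_image hinj] at h0
  have h1 : ∀ u ∈ U, prof m (encA m ↑A) (encA m ↑B) (encS τ) (encS u) = threePartNT τ (↑A : Set (Set (Fin m))) ↑B {u} := by
    intro u _
    have key := profileArr_encA (↑A : Set (Set (Fin m))) ↑B τ u (hpow (encS (u ∆ τ)ᶜ) (encS_lt _))
    rw [← key]
    rfl
  have h2 : ∑ u ∈ U, prof m (encA m ↑A) (encA m ↑B) (encS τ) (encS u) = ∑ u ∈ U, threePartNT τ (↑A : Set (Set (Fin m))) ↑B {u} :=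
    sum_congr rfl h1
  have h3 : 0 ≤ ∑ u ∈ U, threePartNT τ (↑A : Set (Set (Fin m))) ↑B {u} := h2 ▸ h0
  simpa only using h3

/-! ### Chunk ⇒ relative dual cone -/

/-- `tieOk` at the empty node. [this work] -/
theorem tieOk_empty (K : Array ℕ) (mm : ℕ) : tieOk (mkTabs m) #[] K mm = true := by
  rw [tieOk_iff]; intro i _ _; simp [classKey, foldBelow]

/-- **THE EMPTY NODE**: if `coGen A ∪ coGen B = ∅` and a chunk containing the root passes, the profile is in the relative dual cone. [this work] -/
theorem inDualRel_of_root (hm : 2 ^ m ≤ 64) (hpow : ∀ r < 2 ^ m, 2 <<< pc m r = 2 * ((List.range (2 ^ m)).filter fun s => sub s r).length)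
    {A B : Finset (Set (Fin m))} (hAB : PairSat.PairCond A B) (hN : PairSat.coGen A ∪ PairSat.coGen B = ∅) {sel M : ℕ}
    (hsel : (sel.testBit 0 && (0 % M == 0)) = true) (hchunk : chunkCheck m sel M 0 = true) (τ : Set (Fin m)) :
    PairSat.InDualRel (fun y : Set (Fin m) => threePartNT τ (↑A : Set (Set (Fin m))) ↑B {y}) (PairSat.coGen A ∪ PairSat.coGen B) := by
  have hR : Repr m A B #[] 0 := by
    refine ⟨fun j hj => absurd hj (Nat.not_lt_zero _), fun a => ?_, fun b => ?_⟩
    · constructor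
      · intro ha; have : a ∈ PairSat.coGen A ∪ PairSat.coGen B := mem_union_left _ ha; rw [hN] at this; simp at this
      · rintro ⟨j, hj, _⟩; exact absurd hj (Nat.not_lt_zero _)
    · constructor
      · intro hb; have : b ∈ PairSat.coGen A ∪ PairSat.coGen B := mem_union_right _ hb; rw [hN] at this; simp at this
      · rintro ⟨j, hj, _⟩; exact absurd hj (Nat.not_lt_zero _)
  have hsel' : (sel.testBit 0 && ((0 : ℕ) == 0)) = true := by
    rw [Bool.and_eq_true] at hsel ⊢; exact ⟨hsel.1, by simp⟩
  have hgood := (chunkCheck_sound hm hchunk).2 hsel' 0 Nat.one_pos (passes_of _ _ _ _ _ _ (by simp [countBelow])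
    (by simp [countBelow]) (filter₂_eq_zero hR hAB) (tieOk_empty _ _))
  rw [cU_eq_encA hR hAB.upA, cV_eq_encA hR hAB.upB] at hgood
  exact inDualRel_of_good hm hpow (fun y hy q hq hyq => testBit_dFOf_of_le_free hR hy hq hyq) hgood τ

/-- **CHUNK ⇒ RELATIVE DUAL CONE.**  Let `(A, B)` be a conditioned pair with at least one co-generator, whose least code is coloured first (in
`coGen A`), whose node has sorted running keys, sorted full keys and satisfies the tie rule for its colouring; if a chunk selecting the least code
with the node's hash residue passes, then `y ↦ N_τ(A,B,{y})` lies in the relative dual cone for every twist `τ`. [this work] -/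
theorem inDualRel_of_chunkCheck (hm : 2 ^ m ≤ 64)
    (hpow : ∀ r < 2 ^ m, 2 <<< pc m r = 2 * ((List.range (2 ^ m)).filter fun s => sub s r).length) (hC : ChainIdOK m)
    {A B : Finset (Set (Fin m))} (hAB : PairSat.PairCond A B)
    (hne : sortedCodes (PairSat.coGen A ∪ PairSat.coGen B) ≠ [])
    (h0 : pt m ((sortedCodes (PairSat.coGen A ∪ PairSat.coGen B)).getD 0 0) ∈ PairSat.coGen A)
    {sel M : ℕ} (hsel : sel.testBit ((sortedCodes (PairSat.coGen A ∪ PairSat.coGen B)).getD 0 0) = true)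
    (hchunk : chunkCheck m sel M (ptsHash (sortedCodes (PairSat.coGen A ∪ PairSat.coGen B)).toArray % M) = true)
    (hS : keySorted (mkTabs m) (keysOf (mkTabs m) (zeros (mkTabs m)) (sortedCodes (PairSat.coGen A ∪ PairSat.coGen B))) = true)
    (hK : keySorted (mkTabs m) (fullKey (mkTabs m) (sortedCodes (PairSat.coGen A ∪ PairSat.coGen B)).toArray) = true)
    (htie : tieOk (mkTabs m) (sortedCodes (PairSat.coGen A ∪ PairSat.coGen B)).toArray
      (fullKey (mkTabs m) (sortedCodes (PairSat.coGen A ∪ PairSat.coGen B)).toArray)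
      (colouring (PairSat.coGen A) (sortedCodes (PairSat.coGen A ∪ PairSat.coGen B))) = true)
    (τ : Set (Fin m)) :
    PairSat.InDualRel (fun y : Set (Fin m) => threePartNT τ (↑A : Set (Set (Fin m))) ↑B {y}) (PairSat.coGen A ∪ PairSat.coGen B) := by
  set N := PairSat.coGen A ∪ PairSat.coGen B with hN
  set Q := sortedCodes N with hQ
  set mm := colouring (PairSat.coGen A) Q with hmm
  have hR : Repr m A B Q.toArray mm := repr_of_pairCond hAB (fun _ => h0)
  obtain ⟨q₀, Q', hQeq⟩ := List.exists_cons_of_ne_nil hne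
  have hq₀ : Q.getD 0 0 = q₀ := by rw [hQeq]; rfl
  have hmemQ : ∀ q, q ∈ q₀ :: Q' → q ∈ Q := fun q hq => by rw [hQeq]; exact hq
  -- the antichain hypotheses of `chunkCheck_sound_antichain`
  have hch : (q₀ :: Q').Pairwise (· < ·) := hQeq ▸ sortedCodes_pairwise N
  have hlt : ∀ q ∈ q₀ :: Q', q < 2 ^ m := fun q hq => sortedCodes_lt N q (hmemQ q hq)
  have hanti : ∀ q ∈ q₀ :: Q', ∀ q' ∈ q₀ :: Q', q ≠ q' → sub q q' = false :=
    fun q hq q' hq' hne' => sub_false_of_ne hAB.isAntichain_union q (hmemQ q hq) q' (hmemQ q' hq') hne'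
  -- the filters
  have hinj : ∀ j < Q.toArray.size, ∀ j' < Q.toArray.size, Q.toArray.getD j 0 = Q.toArray.getD j' 0 → j = j' := by
    intro j hj j' hj' h
    rw [List.size_toArray] at hj hj'
    rw [SahiHitting.array_getD_eq, SahiHitting.array_getD_eq] at h
    exact sortedCodes_inj N hj hj' h
  obtain ⟨hk1, hk2⟩ := card_coGen_eq_countBelow hR hinj
  obtain ⟨Qb, hQbf, hQba, hcA, hcB⟩ := hAB.big
  have hcb : Qb.card ≤ cbOf m Q.toArray :=
    card_le_cbOf hC Q.toArray Qb hQba fun q hq => (free_iff_testBit_freeOf hR q).1 (hQbf q hq)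
  have hp : passes (mkTabs m) Q.toArray (fullKey (mkTabs m) Q.toArray) (cbOf m Q.toArray) (upNOf m Q.toArray) mm = true :=
    passes_of _ _ _ _ _ _ (by rw [← hk1]; omega) (by rw [← hk2]; omega) (filter₂_eq_zero hR hAB) htie
  have hmmlt : mm < 1 <<< Q'.length := by
    have h1 := colouring_lt (PairSat.coGen A) Q
    have h2 : Q.length - 1 = Q'.length := by rw [hQeq, List.length_cons, Nat.add_sub_cancel]
    rw [h2] at h1
    exact h1
  have hgood := chunkCheck_sound_antichain hm hchunk (q₀ := q₀) (Q' := Q') hch hlt hanti (hq₀ ▸ hsel)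
    (by rw [← hQeq]; exact hS) (by rw [← hQeq]; exact hK) (by rw [← hQeq]) (mm := mm) hmmlt (by rw [← hQeq]; exact hp)
  rw [← hQeq] at hgood
  rw [cU_eq_encA hR hAB.upA, cV_eq_encA hR hAB.upB] at hgood
  exact inDualRel_of_good hm hpow (fun y hy q hq hyq => testBit_dFOf_of_le_free hR hy hq hyq) hgood τ


/-- The code set of a permuted family. [this work] -/
theorem image_encS_mapIso (σ : Equiv.Perm (Fin m)) (N : Finset (Set (Fin m))) :
    (PairSat.mapIso σ.toOrderIsoSet N).image encS = (N.image encS).image (cperm σ) := by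
  ext x
  simp only [mem_image, PairSat.mem_mapIso]
  constructor
  · rintro ⟨z', hz', rfl⟩
    refine ⟨encS (σ.toOrderIsoSet.symm z'), ⟨_, hz', rfl⟩, ?_⟩
    rw [cperm_encS]
    exact congrArg encS (σ.toOrderIsoSet.apply_symm_apply z')
  · rintro ⟨y, ⟨z, hz, rfl⟩, rfl⟩
    refine ⟨σ.toOrderIsoSet z, by rw [OrderIso.symm_apply_apply]; exact hz, ?_⟩
    rw [cperm_encS]; rfl

/-- Code sets of families are below `2^m`. [this work] -/
theorem codeSet_image_encS (N : Finset (Set (Fin m))) : CodeSet m (N.image encS) := by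
  intro x hx; obtain ⟨z, _, rfl⟩ := mem_image.1 hx; exact encS_lt z

/-- **For `m ≤ 6` the second-order part of a key is below `C40 = 2^40`.** [this work] -/
theorem statTri_lt_C40 (hm6 : m ≤ 6) {Q : List ℕ} (hQ : Q.Nodup) (hP : CodeSet m Q.toFinset) (i : ℕ) : statTri m Q i < C40 := by
  have h1 := two_mul_statTri_le hQ m i
  have hc : Q.toFinset.card ≤ 64 := hP.card_le.trans ((Nat.pow_le_pow_right (by norm_num) hm6).trans (by norm_num))
  have h16 : 16 ^ m ≤ 16 ^ 6 := Nat.pow_le_pow_right (by norm_num) hm6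
  have h3 : 3 + 2 * m ≤ 15 := by omega
  have h2 : 2 * statTri m Q i ≤ 64 * 64 * (16 ^ 6 * 15) :=
    h1.trans (Nat.mul_le_mul (Nat.mul_le_mul hc hc) (Nat.mul_le_mul h16 h3))
  have hC : C40 = 2 ^ 40 := by unfold C40; rw [Nat.one_shiftLeft]
  rw [hC]
  norm_num at h2
  omega

/-- **EVERY CONDITIONED PAIR IS COVERED BY THE CHUNKS.** [this work] -/
theorem inDualRel_of_chunks (hm : 2 ^ m ≤ 64) (hm6 : m ≤ 6)
    (hpow : ∀ r < 2 ^ m, 2 <<< pc m r = 2 * ((List.range (2 ^ m)).filter fun s => sub s r).length) (hC : ChainIdOK m)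
    (hroot : ∃ sel M : ℕ, (sel.testBit 0 && (0 % M == 0)) = true ∧ chunkCheck m sel M 0 = true)
    (hchunks : ∀ x < 2 ^ m, ∃ sel M : ℕ, sel.testBit x = true ∧ 0 < M ∧ ∀ r < M, chunkCheck m sel M r = true)
    {A B : Finset (Set (Fin m))} (hAB : PairSat.PairCond A B) (τ : Set (Fin m)) :
    PairSat.InDualRel (fun y : Set (Fin m) => threePartNT τ (↑A : Set (Set (Fin m))) ↑B {y}) (PairSat.coGen A ∪ PairSat.coGen B) := by
  -- the empty node
  by_cases hN : PairSat.coGen A ∪ PairSat.coGen B = ∅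
  · obtain ⟨sel, M, hsel, hchunk⟩ := hroot
    exact inDualRel_of_root hm hpow hAB hN hsel hchunk τ
  -- the statistics of the original pair and the sorting permutation
  set N := PairSat.coGen A ∪ PairSat.coGen B with hNdef
  set P := N.image encS with hP
  set P₁ := (PairSat.coGen A).image encS with hP₁
  set P₂ := (PairSat.coGen B).image encS with hP₂
  set Q := sortedCodes N with hQ
  let f : Fin m → Lex (ℕ × ℕ) := fun i => toLex (statS m P i.val * C40 + statTri m Q i.val, statS m P₁ i.val * statS m P₂ i.val)
  obtain ⟨σ, hmono⟩ := exists_perm_monotone f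
  set e := σ.toOrderIsoSet with he
  -- the permuted pair
  set A' := PairSat.mapIso e A with hA'
  set B' := PairSat.mapIso e B with hB'
  have hAB' : PairSat.PairCond A' B' := PairSat.pairCond_mapIso e hAB
  have hN' : PairSat.coGen A' ∪ PairSat.coGen B' = PairSat.mapIso e N := by
    rw [hA', hB', PairSat.coGen_mapIso, PairSat.coGen_mapIso, ← PairSat.mapIso_union]
  -- it suffices to treat the permuted pair at the permuted twist
  suffices h' : PairSat.InDualRel (fun y' : Set (Fin m) => threePartNT (σ '' τ) (↑A' : Set (Set (Fin m))) ↑B' {y'})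
      (PairSat.coGen A' ∪ PairSat.coGen B') by
    rw [hN'] at h'
    exact inDualRel_profile_of_perm σ τ A B N h'
  -- the node of the permuted pair
  set Q' := sortedCodes (PairSat.coGen A' ∪ PairSat.coGen B') with hQ'
  have hQ'nd : Q'.Nodup := sortedCodes_nodup _
  have hQ'lt : CodesLt m Q' := sortedCodes_lt _
  have hQ'fin : Q'.toFinset = P.image (cperm σ) := by rw [hQ', sortedCodes_toFinset, hN', image_encS_mapIso]
  have hQfin : Q.toFinset = P := by rw [hQ, sortedCodes_toFinset]
  have hPcode : CodeSet m P := codeSet_image_encS N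
  have hP₁' : (PairSat.coGen A').image encS = P₁.image (cperm σ) := by rw [hA', PairSat.coGen_mapIso, image_encS_mapIso]
  have hP₂' : (PairSat.coGen B').image encS = P₂.image (cperm σ) := by rw [hB', PairSat.coGen_mapIso, image_encS_mapIso]
  have hne' : Q' ≠ [] := by
    intro h
    have h1 : (PairSat.coGen A' ∪ PairSat.coGen B').card = 0 := by rw [← sortedCodes_length, ← hQ', h, List.length_nil]
    rw [hN', PairSat.card_mapIso] at h1
    exact hN (card_eq_zero.1 h1)
  -- the keys of the permuted node, through the statistics
  have hKey : ∀ i : Fin m, (fullKey (mkTabs m) Q'.toArray).getD i.val 0 = statS m P (σ.symm i).val * C40 + statTri m Q (σ.symm i).val := by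
    intro i
    rw [fullKey_getD' hQ'lt hQ'nd i.isLt, hQ'fin, statS_image_cperm σ hPcode,
      statTri_cperm σ hPcode (sortedCodes_nodup N) hQ'nd hQfin hQ'fin]
  have hS' : ∀ i : Fin m, (keysOf (mkTabs m) (zeros (mkTabs m)) Q').getD i.val 0 = statS m P (σ.symm i).val := by
    intro i; rw [keysOf_zeros_getD hQ'lt hQ'nd i.isLt, hQ'fin, statS_image_cperm σ hPcode]
  have hmono' : ∀ {i : ℕ} (hi : i + 1 < m),
      statS m P (σ.symm ⟨i, by omega⟩).val * C40 + statTri m Q (σ.symm ⟨i, by omega⟩).val ≤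
        statS m P (σ.symm ⟨i + 1, hi⟩).val * C40 + statTri m Q (σ.symm ⟨i + 1, hi⟩).val ∧
      (statS m P (σ.symm ⟨i, by omega⟩).val * C40 + statTri m Q (σ.symm ⟨i, by omega⟩).val =
        statS m P (σ.symm ⟨i + 1, hi⟩).val * C40 + statTri m Q (σ.symm ⟨i + 1, hi⟩).val →
        statS m P₁ (σ.symm ⟨i, by omega⟩).val * statS m P₂ (σ.symm ⟨i, by omega⟩).val ≤
          statS m P₁ (σ.symm ⟨i + 1, hi⟩).val * statS m P₂ (σ.symm ⟨i + 1, hi⟩).val) := by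
    intro i hi
    have h := hmono (Fin.mk_le_mk.2 (Nat.le_succ i) : (⟨i, by omega⟩ : Fin m) ≤ ⟨i + 1, hi⟩)
    exact Prod.Lex.toLex_le_toLex'.1 h
  have hK' : keySorted (mkTabs m) (fullKey (mkTabs m) Q'.toArray) = true := by
    rw [keySorted_iff]; intro i hi
    have hi' : i + 1 < m := by omega
    rw [show i = (⟨i, by omega⟩ : Fin m).val from rfl, hKey, show (⟨i, _⟩ : Fin m).val + 1 = (⟨i + 1, hi'⟩ : Fin m).val from rfl, hKey]
    exact (hmono' hi').1
  have hSsorted : keySorted (mkTabs m) (keysOf (mkTabs m) (zeros (mkTabs m)) Q') = true := by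
    rw [keySorted_iff]; intro i hi
    have hi' : i + 1 < m := by omega
    rw [show i = (⟨i, by omega⟩ : Fin m).val from rfl, hS', show (⟨i, _⟩ : Fin m).val + 1 = (⟨i + 1, hi'⟩ : Fin m).val from rfl, hS']
    exact statS_le_of_key_le (statTri_lt_C40 hm6 (sortedCodes_nodup N) (hQfin ▸ hPcode) _)
      (statTri_lt_C40 hm6 (sortedCodes_nodup N) (hQfin ▸ hPcode) _) (hmono' hi').1
  -- the tie rule, for either choice of the first class
  have hP₁code : CodeSet m P₁ := codeSet_image_encS _
  have hP₂code : CodeSet m P₂ := codeSet_image_encS _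
  have htie : ∀ {X Y : Finset (Set (Fin m))} {mm : ℕ}, Repr m X Y Q'.toArray mm →
      ((PairSat.coGen X).image encS = P₁.image (cperm σ) ∧ (PairSat.coGen Y).image encS = P₂.image (cperm σ) ∨
        (PairSat.coGen X).image encS = P₂.image (cperm σ) ∧ (PairSat.coGen Y).image encS = P₁.image (cperm σ)) →
      tieOk (mkTabs m) Q'.toArray (fullKey (mkTabs m) Q'.toArray) mm = true := by
    intro X Y mm hR hXY
    rw [tieOk_iff]; intro i hi hKeq
    have hi' : i + 1 < m := by omega
    have hc := fun j => classKey_eq_statS hR hQ'lt hQ'nd j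
    rw [(hc i).1, (hc i).2, (hc (i + 1)).1, (hc (i + 1)).2]
    rw [show i = (⟨i, by omega⟩ : Fin m).val from rfl, hKey, show (⟨i, _⟩ : Fin m).val + 1 = (⟨i + 1, hi'⟩ : Fin m).val from rfl, hKey]
      at hKeq
    have h2 := (hmono' hi').2 hKeq
    rcases hXY with ⟨hX, hY⟩ | ⟨hX, hY⟩
    · rw [hX, hY, show i = (⟨i, by omega⟩ : Fin m).val from rfl, statS_image_cperm σ hP₁code, statS_image_cperm σ hP₂code,
        show (⟨i, _⟩ : Fin m).val + 1 = (⟨i + 1, hi'⟩ : Fin m).val from rfl, statS_image_cperm σ hP₁code, statS_image_cperm σ hP₂code]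
      exact h2
    · rw [hX, hY, show i = (⟨i, by omega⟩ : Fin m).val from rfl, statS_image_cperm σ hP₂code, statS_image_cperm σ hP₁code,
        show (⟨i, _⟩ : Fin m).val + 1 = (⟨i + 1, hi'⟩ : Fin m).val from rfl, statS_image_cperm σ hP₂code, statS_image_cperm σ hP₁code]
      rw [mul_comm, mul_comm (statS m P₂ _)]
      exact h2
  -- the chunk of the least code
  have hx₀lt : Q'.getD 0 0 < 2 ^ m := hQ'lt.getD_lt (List.length_pos_of_ne_nil hne')
  obtain ⟨sel, M, hsel, hM, hall⟩ := hchunks _ hx₀lt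
  have hchunk := hall (ptsHash Q'.toArray % M) (Nat.mod_lt _ hM)
  have hz₀ : pt m (Q'.getD 0 0) ∈ PairSat.coGen A' ∪ PairSat.coGen B' := pt_getD_mem (List.length_pos_of_ne_nil hne')
  -- colour the least code first
  rcases mem_union.1 hz₀ with hzA | hzB
  · exact inDualRel_of_chunkCheck hm hpow hC hAB' hne' hzA hsel hchunk hSsorted hK'
      (htie (repr_of_pairCond hAB' (fun _ => hzA)) (Or.inl ⟨hP₁', hP₂'⟩)) (σ '' τ)
  · -- swap the two classes
    have hQ'' : sortedCodes (PairSat.coGen B' ∪ PairSat.coGen A') = Q' := by rw [union_comm]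
    have hR'' : Repr m B' A' Q'.toArray (colouring (PairSat.coGen B') Q') := by
      have h := repr_of_pairCond hAB'.symm (fun _ => by rw [hQ'']; exact hzB)
      rw [hQ''] at h
      exact h
    have h := inDualRel_of_chunkCheck hm hpow hC hAB'.symm (by rw [hQ'']; exact hne') (by rw [hQ'']; exact hzB)
      (by rw [hQ'']; exact hsel) (by rw [hQ'']; exact hchunk) (by rw [hQ'']; exact hSsorted) (by rw [hQ'']; exact hK')
      (by rw [hQ'']; exact htie hR'' (Or.inr ⟨hP₂', hP₁'⟩)) (σ '' τ)
    rw [union_comm (PairSat.coGen B')] at h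
    have hprof : (fun y' : Set (Fin m) => threePartNT (σ '' τ) (↑B' : Set (Set (Fin m))) ↑A' {y'}) =
        fun y' : Set (Fin m) => threePartNT (σ '' τ) (↑A' : Set (Set (Fin m))) ↑B' {y'} :=
      funext fun y' => (threePartNT_swap12 _ _ _ _).symm
    rw [hprof] at h
    exact h

/-- **`N_τ(𝒰,𝒱,𝒲) ≥ 0` FOR ALL UP-SETS, from the chunks.** [this work] -/
theorem threePartNT_nonneg_of_chunks (hm : 2 ^ m ≤ 64) (hm6 : m ≤ 6)
    (hpow : ∀ r < 2 ^ m, 2 <<< pc m r = 2 * ((List.range (2 ^ m)).filter fun s => sub s r).length) (hC : ChainIdOK m)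
    (hroot : ∃ sel M : ℕ, (sel.testBit 0 && (0 % M == 0)) = true ∧ chunkCheck m sel M 0 = true)
    (hchunks : ∀ x < 2 ^ m, ∃ sel M : ℕ, sel.testBit x = true ∧ 0 < M ∧ ∀ r < M, chunkCheck m sel M r = true)
    (τ : Set (Fin m)) {𝒰 𝒱 𝒲 : Set (Set (Fin m))} (h𝒰 : IsUpperSet 𝒰) (h𝒱 : IsUpperSet 𝒱) (h𝒲 : IsUpperSet 𝒲) :
    0 ≤ threePartNT τ 𝒰 𝒱 𝒲 :=
  threePartNT_nonneg_of_pairCondRel τ (fun _ _ hAB => inDualRel_of_chunks hm hm6 hpow hC hroot hchunks hAB τ) h𝒰 h𝒱 h𝒲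

end Summit.CriticalPhenomena.PercolationContinuityZ3.Theorems.ThreePartition.Cube
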